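import Summits.Ventures.HSemireg.Pad4TowerRuleDMu4

/-!
# Venture HSemireg — PAD-4: RULE D on 𝔅(μ₄) is MONOTONE in the partner set and SELF-DUAL under the literal dual; the G-orbit key

HONEST FRAMING. Lean index of the computation cell `pub-hsemireg` (S4-PUSH, H2 door PAD-4), typed by the Ventures-side typer
`hodge-lit-semireg-typer-2` (g3), on line stmt-HodgeConjecture-18881 ∕ `Cruxes/BlochSeedDiscOne/Lines/birth.lean` 814a6a70c14e831a ∕
`stub_rung_pad4_seedAt` (screen (U): closure rules; card v4.1 row «typer-2 tower rows → (U)»). Companion of `Pad4TowerRuleDMu4` (row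
771): three pieces of bookkeeping that the cell's alternation engines use as axioms of their own soundness arguments and that the kernel
file `Pad4TowerXStaticSafe2` (LEMMA SAFE2) consumes. Everything here is PROVED; no fact, no `sorry`, no `instance`, no notation.

(1) MONOTONICITY (`ruleDMu4N_mono`, `ruleDMu4P_mono`): RULE D at a cell only asks for the PRESENCE of legs and covers, so it is monotone
in the configuration — «the RULE-D core of a set containing T contains T, RULE D being monotone in the partner set» (LEMMA SAFE2 text,
`general-structure/LEMMA-SAFE2-gs2g50.md` 86089cd465aa28ed, §LEMMA).
(2) THE LITERAL DUAL (`dualPt h x = (h − α, −β)`, `MConfig.dual`: levels swapped) of `xtwo.py` 7c088360043cc0d5 («LITERAL DUALISATION: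
D^∨ := (−P, −N) + h·I (levels swapped, every letter x ↦ (h − α, −β))») and the SELF-DUALITY OF THE TYPED RULE D: `ruleDMu4N_dual`
(`RuleDMu4P (C.dual h) (dualCell h Z) ↔ RuleDMu4N C Z`), `ruleDMu4P_dual`, **`ruleDMu4Closed_dual`** — the engines' standing remark
«RULE-D-closedness and admissibility are self-dual» (SAFE2 §LEMMA, last sentence; xtwo.py header) as a kernel theorem for the typed
predicate: a leg `Z = P + d·n_k` below dualises to the leg `P^∨ = Z^∨ + d·n_k` above in the SAME direction index `k`, frame coordinates go
to `h − coord`, adaptedness, apex points and `DirOK` are unchanged.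
(3) THE G-ORBIT KEY (`GKeyRel`) = `xinf.py` `okey` («orbit key: (level, sorted shape letters, phase class or None)»): two cells are
related iff a permutation of the factors matches the shapes `(α, |β|²)` factorwise and, when all four factors are charged, the phase
classes `Σ_f k_f (mod 4)` agree — on μ₄-phased cells this is the orbit relation of `G = {ζ ∈ μ₄⁴ : Π ζ_f = 1} ⋊ S₄` (an uncharged
factor absorbs the product condition), which is how the engines implement G-invariance (S-iii) and the certificate (C1) «sibling in the
G-orbit of Z». `phaseK` is the half-open phase QUADRANT of `β` (= the μ₄ phase index `k`, `β = c·conj(i^k)`, on μ₄ letters), chosen so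
that `β ↦ −β` shifts it by `2` for EVERY `β ≠ 0`; hence **`gKeyRel_dual`**: the key relation commutes with the literal dual. FLAG G-1:
on letters that are charged but not μ₄-phased the key is coarser than any group orbit (no such letter occurs in a census universe).

NOT HERE: the X-PHASE instances, LEMMA SAFE2, admissibility (file `Pad4TowerXStaticSafe2`); any meaning of RULE D beyond the typed
predicate (pencil, `Pad4TowerRuleDMu4` docstring). Nothing is a statement about a variety, a sheaf, `σ`, a seed or an abelian variety;
NOTHING HERE SAYS THAT HC ∕ HC_CM ∕ HC_AV ∕ W₆ ∕ HC_Kum4Type HOLDS OR FAILS; census-neutral. Typed ≠ proved ≠ endorsed.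

SOURCES (sha16): `general-structure/LEMMA-SAFE2-gs2g50.md` 86089cd465aa28ed (gs-eng-2 g50; hostile reads ×2 s4-ref-2 g21 ∕ s4-ref g81,
files `s4push/VERDICT-LEMMA-SAFE2-…`); code of record `general-structure/gs2/g49/xinf/xinf.py` (`okey`, `shape_letter`, `phase_k`), `xtwo.py`
7c088360043cc0d5 (`dual_letter`), `xgen.py` 4d8a39e1321a726d; `Pad4TowerRuleDMu4.lean` 7f3a78a9d76f5e0c (p551028); `Pad4TowerRuleDMu4Slice.lean` (p554734).
-/

namespace Summit.Ventures.HSemireg.Pad4Tower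

open Finset

/-! ## §1 Sub-configurations; RULE D is monotone in the partner set -/

/-- `T ⊆ S` levelwise (`N`-cells and `P`-cells). -/
abbrev MConfig.sub (T S : MConfig) : Prop := T.lower ⊆ S.lower ∧ T.upper ⊆ S.upper

section Mono

variable {T S : MConfig}

/-- service below is monotone in the `P`-cells. -/
theorem mServedBelow_mono (h : T.sub S) {Z : MCell} {f k : Fin 4} :
    MServedBelow T Z f k → MServedBelow S Z f k := fun ⟨P, hP, hPZ⟩ => ⟨P, h.2 hP, hPZ⟩

/-- service above is monotone in the `N`-cells. -/
theorem mServedAbove_mono (h : T.sub S) {P : MCell} {f k : Fin 4} :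
    MServedAbove T P f k → MServedAbove S P f k := fun ⟨N, hN, hNP⟩ => ⟨N, h.1 hN, hNP⟩

/-- settledness below is monotone. -/
theorem settledBelow_mono (h : T.sub S) {Z : MCell} {f k : Fin 4} :
    SettledBelow T Z f k → SettledBelow S Z f k := fun ⟨r, hr, hs⟩ => ⟨r, hr, mServedBelow_mono h hs⟩

/-- settledness above is monotone. -/
theorem settledAbove_mono (h : T.sub S) {P : MCell} {f k : Fin 4} :
    SettledAbove T P f k → SettledAbove S P f k := fun ⟨r, hr, hs⟩ => ⟨r, hr, mServedAbove_mono h hs⟩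

/-- covers below are monotone. -/
theorem coveredBelow_mono (h : T.sub S) {Z : MCell} {g k j k' : Fin 4} :
    CoveredBelow T Z g k j k' → CoveredBelow S Z g k j k' :=
  fun ⟨a, b, ha, hb, P, hP, hrest⟩ => ⟨a, b, ha, hb, P, h.2 hP, hrest⟩

/-- covers above are monotone. -/
theorem coveredAbove_mono (h : T.sub S) {P : MCell} {g k j k' : Fin 4} :
    CoveredAbove T P g k j k' → CoveredAbove S P g k j k' :=
  fun ⟨a, b, ha, hb, N, hN, hrest⟩ => ⟨a, b, ha, hb, N, h.1 hN, hrest⟩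

/-- **RULE D at an `N`-cell is monotone in the configuration** (LEMMA SAFE2: «RULE D being monotone in the partner set»). -/
theorem ruleDMu4N_mono (h : T.sub S) {Z : MCell} (hZ : RuleDMu4N T Z) : RuleDMu4N S Z :=
  fun g j hgj k k' hk hk' hne =>
    (hZ g j hgj k k' hk hk' hne).imp (settledBelow_mono h) (Or.imp (settledBelow_mono h) (coveredBelow_mono h))

/-- **RULE D at a `P`-cell is monotone in the configuration.** -/
theorem ruleDMu4P_mono (h : T.sub S) {P : MCell} (hP : RuleDMu4P T P) : RuleDMu4P S P :=
  fun g j hgj k k' hk hk' hne =>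
    (hP g j hgj k k' hk hk' hne).imp (settledAbove_mono h) (Or.imp (settledAbove_mono h) (coveredAbove_mono h))

end Mono

/-! ## §2 The literal dual `x ↦ (h − α, −β)`, levels swapped (xtwo.py `dual_letter`) -/

/-- the dual letter `(h − α, −β)` of `x = (α, Re β, Im β)` (xtwo.py: «every letter x ↦ (h − alpha, −beta)»; `h` is any integer —
the engines take `h = max(α + |β|)` over the alphabet to stay non-negative, which plays no role here). -/
abbrev dualPt (h : ℤ) (x : BPoint) : BPoint := (h - x.1, -x.2.1, -x.2.2)

/-- the dual cell, factorwise. -/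
abbrev dualCell (h : ℤ) (Z : MCell) : MCell := fun f => dualPt h (Z f)

/-- **the literal dual configuration `D^∨ = (−P, −N) + h·I`**: the `N`-cells of the dual are the duals of the `P`-cells and
conversely (xtwo.py `dual_support`). -/
abbrev MConfig.dual (h : ℤ) (C : MConfig) : MConfig := ⟨C.upper.image (dualCell h), C.lower.image (dualCell h)⟩

/-- the dual is an involution on points … -/
theorem dualPt_dualPt (h : ℤ) (x : BPoint) : dualPt h (dualPt h x) = x := by
  obtain ⟨a, b, c⟩ := x
  simp

/-- … on cells … -/
theorem dualCell_dualCell (h : ℤ) (Z : MCell) : dualCell h (dualCell h Z) = Z :=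
  funext fun f => dualPt_dualPt h (Z f)

/-- … hence injective on points … -/
theorem dualPt_injective (h : ℤ) : Function.Injective (dualPt h) := fun x y e => by
  have := congrArg (dualPt h) e
  rwa [dualPt_dualPt, dualPt_dualPt] at this

/-- … and on cells. -/
theorem dualCell_injective (h : ℤ) : Function.Injective (dualCell h) := fun X Y e => by
  have := congrArg (dualCell h) e
  rwa [dualCell_dualCell, dualCell_dualCell] at this

/-- membership in the dual's `N`-cells. -/
theorem mem_dual_lower {h : ℤ} {C : MConfig} {Z : MCell} : Z ∈ (C.dual h).lower ↔ dualCell h Z ∈ C.upper := by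
  constructor
  · intro hZ
    obtain ⟨P, hP, hPZ⟩ := Finset.mem_image.mp hZ
    rw [← hPZ, dualCell_dualCell]
    exact hP
  · intro hZ
    exact Finset.mem_image.mpr ⟨dualCell h Z, hZ, dualCell_dualCell h Z⟩

/-- membership in the dual's `P`-cells. -/
theorem mem_dual_upper {h : ℤ} {C : MConfig} {P : MCell} : P ∈ (C.dual h).upper ↔ dualCell h P ∈ C.lower := by
  constructor
  · intro hP
    obtain ⟨N, hN, hNP⟩ := Finset.mem_image.mp hP
    rw [← hNP, dualCell_dualCell]
    exact hN
  · intro hP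
    exact Finset.mem_image.mpr ⟨dualCell h P, hP, dualCell_dualCell h P⟩

/-- the dual of a `P`-cell is an `N`-cell of the dual. -/
theorem dualCell_mem_dual_lower {h : ℤ} {C : MConfig} {P : MCell} (hP : P ∈ C.upper) :
    dualCell h P ∈ (C.dual h).lower :=
  Finset.mem_image_of_mem _ hP

/-- the dual of an `N`-cell is a `P`-cell of the dual. -/
theorem dualCell_mem_dual_upper {h : ℤ} {C : MConfig} {Z : MCell} (hZ : Z ∈ C.lower) :
    dualCell h Z ∈ (C.dual h).upper :=
  Finset.mem_image_of_mem _ hZ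

/-- the dual is an involution on configurations. -/
theorem dual_dual (h : ℤ) (C : MConfig) : (C.dual h).dual h = C := by
  have hid : dualCell h ∘ dualCell h = id := funext (dualCell_dualCell h)
  cases C
  simp only [MConfig.dual, Finset.image_image, hid, Finset.image_id]

/-- the dual is monotone. -/
theorem dual_sub {h : ℤ} {T S : MConfig} (hTS : T.sub S) : (T.dual h).sub (S.dual h) :=
  ⟨Finset.image_subset_image hTS.2, Finset.image_subset_image hTS.1⟩

/-! ## §3 Self-duality of legs, covers, frames and RULE D -/

/-- agreement off a factor is unchanged by the dual (either order). -/
theorem magree_dual {h : ℤ} {X Z : MCell} {σ : Fin 4} : MAgree (dualCell h X) (dualCell h Z) σ ↔ MAgree Z X σ :=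
  ⟨fun hg g hgσ => (dualPt_injective h (hg g hgσ)).symm, fun hg g hgσ => congrArg (dualPt h) (hg g hgσ).symm⟩

/-- agreement off two factors is unchanged by the dual (either order). -/
theorem magree2_dual {h : ℤ} {X Z : MCell} {g j : Fin 4} :
    MAgree2 (dualCell h X) (dualCell h Z) g j ↔ MAgree2 Z X g j :=
  ⟨fun hg f h1 h2 => (dualPt_injective h (hg f h1 h2)).symm, fun hg f h1 h2 => congrArg (dualPt h) (hg f h1 h2).symm⟩

/-- **a leg dualises to a leg in the same direction index**: `x` lies `d ≥ 1` steps of direction `k` ABOVE `y` iff `y^∨` lies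
`d` steps of direction `k` above `x^∨`. -/
theorem ray_dual_iff (h : ℤ) (x y : BPoint) (k : Fin 4) :
    ((dualPt h x).1 < (dualPt h y).1 ∧ dualPt h y = ray (dualPt h x) k ((dualPt h y).1 - (dualPt h x).1)) ↔
      (y.1 < x.1 ∧ x = ray y k (x.1 - y.1)) := by
  obtain ⟨x1, x2, x3⟩ := x
  obtain ⟨y1, y2, y3⟩ := y
  fin_cases k <;> simp [ray, Prod.ext_iff] <;> omega

/-- a `k`-partner `q` BELOW `Z` on `σ` dualises to the `k`-partner `Z^∨` below `q^∨`, i.e. `q^∨` is `Z^∨ + d·n_k` ABOVE. -/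
theorem uPartner_dual (h : ℤ) (Z q : MCell) (σ k : Fin 4) :
    UPartner (dualCell h q) (dualCell h Z) σ k ↔ UPartner Z q σ k := by
  constructor
  · rintro ⟨hag, hlt, hray⟩
    exact ⟨(magree_dual (h := h)).mp hag, ((ray_dual_iff h (Z σ) (q σ) k).mp ⟨hlt, hray⟩).1,
      ((ray_dual_iff h (Z σ) (q σ) k).mp ⟨hlt, hray⟩).2⟩
  · rintro ⟨hag, hlt, hray⟩
    obtain ⟨hlt', hray'⟩ := (ray_dual_iff h (Z σ) (q σ) k).mpr ⟨hlt, hray⟩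
    exact ⟨(magree_dual (h := h)).mpr hag, hlt', hray'⟩

/-- service below dualises to service above. -/
theorem mServedBelow_dual (h : ℤ) {C : MConfig} {Z : MCell} {f k : Fin 4} :
    MServedAbove (C.dual h) (dualCell h Z) f k ↔ MServedBelow C Z f k := by
  constructor
  · rintro ⟨N, hN, hNZ⟩
    refine ⟨dualCell h N, mem_dual_lower.mp hN, (uPartner_dual h Z (dualCell h N) f k).mp ?_⟩
    rwa [dualCell_dualCell]
  · rintro ⟨P, hP, hPZ⟩
    exact ⟨dualCell h P, dualCell_mem_dual_lower hP, (uPartner_dual h Z P f k).mpr hPZ⟩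

/-- service above dualises to service below. -/
theorem mServedAbove_dual (h : ℤ) {C : MConfig} {P : MCell} {f k : Fin 4} :
    MServedBelow (C.dual h) (dualCell h P) f k ↔ MServedAbove C P f k := by
  rw [← mServedBelow_dual h (C := C.dual h), dual_dual, dualCell_dualCell]

/-- settledness dualises. -/
theorem settledBelow_dual (h : ℤ) {C : MConfig} {Z : MCell} {f k : Fin 4} :
    SettledAbove (C.dual h) (dualCell h Z) f k ↔ SettledBelow C Z f k :=
  exists_congr fun _ => and_congr Iff.rfl (mServedBelow_dual h)

/-- settledness dualises (other side). -/
theorem settledAbove_dual (h : ℤ) {C : MConfig} {P : MCell} {f k : Fin 4} :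
    SettledBelow (C.dual h) (dualCell h P) f k ↔ SettledAbove C P f k := by
  rw [← settledBelow_dual h (C := C.dual h), dual_dual, dualCell_dualCell]

/-- an (r2a) cover below dualises to an (r2a) cover above with the same two direction indices. -/
theorem mCoverBelow_dual (h : ℤ) {C : MConfig} {Z : MCell} {g a j b : Fin 4} :
    MCoverAbove (C.dual h) (dualCell h Z) g a j b ↔ MCoverBelow C Z g a j b := by
  constructor
  · rintro ⟨N, hN, hag, hltg, hrg, hltj, hrj⟩
    have eN : N = dualCell h (dualCell h N) := (dualCell_dualCell h N).symm
    rw [eN] at hag hltg hrg hltj hrj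
    obtain ⟨hltg', hrg'⟩ := (ray_dual_iff h (Z g) (dualCell h N g) a).mp ⟨hltg, hrg⟩
    obtain ⟨hltj', hrj'⟩ := (ray_dual_iff h (Z j) (dualCell h N j) b).mp ⟨hltj, hrj⟩
    exact ⟨dualCell h N, mem_dual_lower.mp hN, fun f h1 h2 => ((magree2_dual (h := h)).mp hag f h1 h2).symm,
      hltg', hrg', hltj', hrj'⟩
  · rintro ⟨P, hP, hag, hltg, hrg, hltj, hrj⟩
    obtain ⟨hltg', hrg'⟩ := (ray_dual_iff h (Z g) (P g) a).mpr ⟨hltg, hrg⟩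
    obtain ⟨hltj', hrj'⟩ := (ray_dual_iff h (Z j) (P j) b).mpr ⟨hltj, hrj⟩
    exact ⟨dualCell h P, dualCell_mem_dual_lower hP, (magree2_dual (h := h)).mpr fun f h1 h2 => (hag f h1 h2).symm,
      hltg', hrg', hltj', hrj'⟩

/-- apex points are unchanged by the dual. -/
theorem isApex_dual (h : ℤ) (x : BPoint) : isApex (dualPt h x) ↔ isApex x := by
  simp [isApex]

/-- `DirOK` is unchanged by the dual. -/
theorem dirOK_dual (h : ℤ) (x : BPoint) (k a : Fin 4) : DirOK (dualPt h x) k a ↔ DirOK x k a := by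
  simp only [DirOK, isApex_dual]

/-- covered pairs dualise. -/
theorem coveredBelow_dual (h : ℤ) {C : MConfig} {Z : MCell} {g k j k' : Fin 4} :
    CoveredAbove (C.dual h) (dualCell h Z) g k j k' ↔ CoveredBelow C Z g k j k' :=
  exists_congr fun a => exists_congr fun b =>
    and_congr (dirOK_dual h (Z g) k a) (and_congr (dirOK_dual h (Z j) k' b) (mCoverBelow_dual h))

/-- covered pairs dualise (other side). -/
theorem coveredAbove_dual (h : ℤ) {C : MConfig} {P : MCell} {g k j k' : Fin 4} :
    CoveredBelow (C.dual h) (dualCell h P) g k j k' ↔ CoveredAbove C P g k j k' := by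
  rw [← coveredBelow_dual h (C := C.dual h), dual_dual, dualCell_dualCell]

/-- adaptedness is unchanged by the dual. -/
theorem adapted_dual (h : ℤ) (x : BPoint) (k : Fin 4) : Adapted (dualPt h x) k ↔ Adapted x k := by
  fin_cases k <;> simp [Adapted]

/-- frame coordinates go to `h − coord`. -/
theorem coord_dual (h : ℤ) (x : BPoint) (k : Fin 4) : coord (dualPt h x) k = h - coord x k := by
  fin_cases k <;> simp [coord] <;> ring

/-- **RULE D IS SELF-DUAL, `N`-side**: RULE D at the `N`-cell `Z` of `C` is RULE D at the `P`-cell `Z^∨` of `C^∨`. -/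
theorem ruleDMu4N_dual (h : ℤ) (C : MConfig) (Z : MCell) : RuleDMu4P (C.dual h) (dualCell h Z) ↔ RuleDMu4N C Z := by
  constructor
  · intro hP g j hgj k k' hk hk' hne
    have hne' : coord (dualCell h Z g) k ≠ coord (dualCell h Z j) k' := by
      rw [show dualCell h Z g = dualPt h (Z g) from rfl, show dualCell h Z j = dualPt h (Z j) from rfl, coord_dual,
        coord_dual]
      omega
    rcases hP g j hgj k k' ((adapted_dual h (Z g) k).mpr hk) ((adapted_dual h (Z j) k').mpr hk') hne' with h1 | h2 | h3
    · exact Or.inl ((settledBelow_dual h).mp h1)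
    · exact Or.inr (Or.inl ((settledBelow_dual h).mp h2))
    · exact Or.inr (Or.inr ((coveredBelow_dual h).mp h3))
  · intro hN g j hgj k k' hk hk' hne
    have hne' : coord (Z g) k ≠ coord (Z j) k' := by
      rw [show dualCell h Z g = dualPt h (Z g) from rfl, show dualCell h Z j = dualPt h (Z j) from rfl, coord_dual,
        coord_dual] at hne
      omega
    rcases hN g j hgj k k' ((adapted_dual h (Z g) k).mp hk) ((adapted_dual h (Z j) k').mp hk') hne' with h1 | h2 | h3
    · exact Or.inl ((settledBelow_dual h).mpr h1)
    · exact Or.inr (Or.inl ((settledBelow_dual h).mpr h2))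
    · exact Or.inr (Or.inr ((coveredBelow_dual h).mpr h3))

/-- **RULE D IS SELF-DUAL, `P`-side.** -/
theorem ruleDMu4P_dual (h : ℤ) (C : MConfig) (P : MCell) : RuleDMu4N (C.dual h) (dualCell h P) ↔ RuleDMu4P C P := by
  rw [← ruleDMu4N_dual h (C.dual h) (dualCell h P), dual_dual, dualCell_dualCell]

/-- **RULE-D-CLOSEDNESS IS SELF-DUAL** (SAFE2 text: «RULE-D-closedness and admissibility are self-dual»; xtwo.py header), for the
typed predicate `RuleDMu4Closed` of row 771. -/
theorem ruleDMu4Closed_dual (h : ℤ) (C : MConfig) : RuleDMu4Closed (C.dual h) ↔ RuleDMu4Closed C := by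
  constructor
  · rintro ⟨hN, hP⟩
    exact ⟨fun Z hZ => (ruleDMu4N_dual h C Z).mp (hP _ (dualCell_mem_dual_upper hZ)),
      fun P hP' => (ruleDMu4P_dual h C P).mp (hN _ (dualCell_mem_dual_lower hP'))⟩
  · rintro ⟨hN, hP⟩
    refine ⟨fun Z hZ => ?_, fun P hP' => ?_⟩
    · have := (ruleDMu4P_dual h C (dualCell h Z)).mpr (hP _ (mem_dual_lower.mp hZ))
      rwa [dualCell_dualCell] at this
    · have := (ruleDMu4N_dual h C (dualCell h P)).mpr (hN _ (mem_dual_upper.mp hP'))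
      rwa [dualCell_dualCell] at this

/-! ## §4 The G-orbit key (xinf.py `okey`) and its compatibility with the dual -/

/-- `|β|²`. -/
abbrev bnormSq (x : BPoint) : ℤ := x.2.1 ^ 2 + x.2.2 ^ 2

/-- the PHASE QUADRANT of `β` (half-open quadrants; on a μ₄ letter `c·ℓ_{i^k}`, `β = c·conj(i^k)`, this is `k`: `(c,0) ↦ 0`,
`(0,−c) ↦ 1`, `(−c,0) ↦ 2`, `(0,c) ↦ 3`; `β = 0 ↦ 0`, immaterial). Chosen so that `β ↦ −β` adds `2` for every `β ≠ 0`. -/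
abbrev phaseK (x : BPoint) : Fin 4 :=
  if 0 < x.2.1 ∧ x.2.2 ≤ 0 then 0 else if x.2.1 ≤ 0 ∧ x.2.2 < 0 then 1 else if x.2.1 < 0 ∧ 0 ≤ x.2.2 then 2
    else if 0 ≤ x.2.1 ∧ 0 < x.2.2 then 3 else 0

/-- a FULLY CHARGED cell: no apex factor (`β_f ≠ 0` for all `f`). -/
abbrev FCCell (X : MCell) : Prop := ∀ f, ¬ isApex (X f)

/-- **the G-orbit key relation** (xinf.py `okey` equality, used by xgen.py for G-invariance and for (C1)): a permutation of the
factors matches the shapes `(α, |β|²)` factorwise, and for fully charged cells the phase classes `Σ_f k_f (mod 4)` agree. On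
μ₄-phased cells = «`Y` lies in the orbit of `X` under `{ζ ∈ μ₄⁴ : Π ζ_f = 1} ⋊ S₄`» (FLAG G-1 of the module docstring otherwise). -/
abbrev GKeyRel (X Y : MCell) : Prop :=
  (∃ π : Equiv.Perm (Fin 4), ∀ f, (Y f).1 = (X (π f)).1 ∧ bnormSq (Y f) = bnormSq (X (π f))) ∧
    (FCCell X → (∑ f, phaseK (Y f)) = ∑ f, phaseK (X f))

/-- a point is charged iff `|β|² ≠ 0`. -/
theorem not_isApex_iff (x : BPoint) : ¬ isApex x ↔ bnormSq x ≠ 0 := by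
  obtain ⟨a, b, c⟩ := x
  constructor
  · intro hx hb
    apply hx
    have hb' : b ^ 2 + c ^ 2 = 0 := hb
    constructor
    · simpa using (show b ^ 2 = 0 by nlinarith [sq_nonneg b, sq_nonneg c])
    · simpa using (show c ^ 2 = 0 by nlinarith [sq_nonneg b, sq_nonneg c])
  · rintro hx ⟨hb, hc⟩
    apply hx
    simp only at hb hc
    simp [bnormSq, hb, hc]

/-- shapes matched factorwise transport full charge. -/
theorem fcCell_of_shapes {X Y : MCell} (π : Equiv.Perm (Fin 4)) (hπ : ∀ f, bnormSq (Y f) = bnormSq (X (π f)))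
    (hX : FCCell X) : FCCell Y := fun f =>
  (not_isApex_iff (Y f)).mpr (by rw [hπ f]; exact (not_isApex_iff _).mp (hX (π f)))

/-- the phase quadrant of `−β` is that of `β` plus `2` (`β ≠ 0`). -/
theorem phaseK_dual (h : ℤ) {x : BPoint} (hx : ¬ isApex x) : phaseK (dualPt h x) = phaseK x + 2 := by
  obtain ⟨a, b, c⟩ := x
  simp only [isApex, not_and] at hx
  simp only [phaseK, Left.neg_pos_iff, neg_nonpos, Left.neg_neg_iff, neg_nonneg]
  split_ifs <;> first | decide | (exfalso; omega)

/-- `|β|²` is unchanged by the dual. -/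
theorem bnormSq_dual (h : ℤ) (x : BPoint) : bnormSq (dualPt h x) = bnormSq x := by
  simp [bnormSq]

/-- full charge is unchanged by the dual. -/
theorem fcCell_dual (h : ℤ) (X : MCell) : FCCell (dualCell h X) ↔ FCCell X :=
  forall_congr' fun f => not_congr (isApex_dual h (X f))

/-- on a fully charged cell the phase class is unchanged by the dual (`4·2 ≡ 0`). -/
theorem sum_phaseK_dual (h : ℤ) {X : MCell} (hX : FCCell X) : (∑ f, phaseK (dualCell h X f)) = ∑ f, phaseK (X f) := by
  have e : ∀ f, phaseK (dualCell h X f) = phaseK (X f) + 2 := fun f => phaseK_dual h (hX f)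
  simp only [e, Finset.sum_add_distrib, Finset.sum_const, Finset.card_univ, Fintype.card_fin]
  rw [show (4 • (2 : Fin 4)) = 0 from by decide, add_zero]

/-- **the G-orbit key commutes with the literal dual** (so a G-invariant support has a G-invariant dual, which is how the mirror
kills inherit (C1)). -/
theorem gKeyRel_dual (h : ℤ) (X Y : MCell) : GKeyRel (dualCell h X) (dualCell h Y) ↔ GKeyRel X Y := by
  have hsh : ∀ π : Equiv.Perm (Fin 4),
      (∀ f, (dualCell h Y f).1 = (dualCell h X (π f)).1 ∧ bnormSq (dualCell h Y f) = bnormSq (dualCell h X (π f))) ↔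
        ∀ f, (Y f).1 = (X (π f)).1 ∧ bnormSq (Y f) = bnormSq (X (π f)) := fun π =>
    forall_congr' fun f => by
      rw [show dualCell h Y f = dualPt h (Y f) from rfl, show dualCell h X (π f) = dualPt h (X (π f)) from rfl,
        bnormSq_dual, bnormSq_dual]
      exact and_congr ⟨fun e => by simp only at e; omega, fun e => by simp only; omega⟩ Iff.rfl
  constructor
  · rintro ⟨⟨π, hπ⟩, hph⟩
    have hπ' := (hsh π).mp hπ
    refine ⟨⟨π, hπ'⟩, fun hX => ?_⟩
    have hY : FCCell Y := fcCell_of_shapes π (fun f => (hπ' f).2) hX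
    have := hph ((fcCell_dual h X).mpr hX)
    rwa [sum_phaseK_dual h hX, sum_phaseK_dual h hY] at this
  · rintro ⟨⟨π, hπ⟩, hph⟩
    refine ⟨⟨π, (hsh π).mpr hπ⟩, fun hX' => ?_⟩
    have hX : FCCell X := (fcCell_dual h X).mp hX'
    have hY : FCCell Y := fcCell_of_shapes π (fun f => (hπ f).2) hX
    rw [sum_phaseK_dual h hX, sum_phaseK_dual h hY]
    exact hph hX

/-- closure of the `P`-cells under the key relation gives closure of the dual's `N`-cells (used for the mirror kills). -/
theorem gKeyRel_closed_dual_lower (h : ℤ) {T : MConfig} (hcl : ∀ P ∈ T.upper, ∀ n, GKeyRel P n → n ∈ T.upper) :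
    ∀ Z ∈ (T.dual h).lower, ∀ n, GKeyRel Z n → n ∈ (T.dual h).lower := fun Z hZ n hZn =>
  mem_dual_lower.mpr (hcl _ (mem_dual_lower.mp hZ) _ ((gKeyRel_dual h Z n).mpr hZn))

end Summit.Ventures.HSemireg.Pad4Tower
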